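import Literature.NumberTheory.IwasawaTheory.ClassicalMuVanishesSemidihedralDescent
import Literature.NumberTheory.IwasawaTheory.ClassNumberPExpCoprimeGaloisCongruence
import Literature.NumberTheory.EllipticCurves.ZpExtensionRestrictTwoSqrtTwoAnyDegree
import HarnessLib

set_option autoImplicit false

/-!
# Transport of the cyclotomic `ℤ₂`-tower data along a `ℚ`-isomorphism of number fields of ANY degree, given `√2 ∉ E`

Topic `NumberTheory/IwasawaTheory` (namespace = path). THEOREM-ONLY file (no definition, no named fact, no `sorry`), written by the prover seat
`bsd-line-att-p4` g31 (cell `bsd-f1-sign2`; `--supports` stmt-BirchSwinnertonDyer-22298). The tree's `forall_classicalMuVanishes_of_algEquiv`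
(`ClassicalMuVanishesSemidihedralDescent`) transports the input «`μ = 0` for every cyclotomic `ℤ_p`-extension» along `E ≃ₐ[F] E'` under
`p ∤ [E : F]`; at `p = 2` this excludes the even-degree carriers of the cell (the sextics `ℚ(W[2])`, `ℚ(β, i)`, the degree-`12` field
`ℚ(W[2], i)`). Here the degree hypothesis is replaced by **`√2 ∉ E`** (`∀ x : E, x² ≠ 2`), which is what makes the cyclotomic tower of `E` the
restriction of that of `ℚ` (`E ∩ ℚ_∞ = ℚ`; att-p4 g29's degree-free criterion `surjective_comp_absGaloisRestrict_of_forall_sq_ne_two'`):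

* `classNumberPExp_eq_of_algEquiv_of_forall_sq_ne_two` — `φ : E ≃ₐ[ℚ] E'`, `√2 ∉ E`, `κ, κ'` cyclotomic `ℤ₂`-extensions of `E`, `E'` ⟹
  `e_n(κ) = e_n(κ')` for every `n`;
* `classicalMuVanishes_iff_of_algEquiv_of_forall_sq_ne_two`, `forall_classicalMuVanishes_iff_of_algEquiv_of_forall_sq_ne_two` (the `μ = 0` input),
  `classicalLambda_eq_of_algEquiv_of_forall_sq_ne_two` (`λ`).

References: [Washington1997] §13.1 (the layers `E·ℚ_n`; `ℚ_1 = ℚ(√2)`); tree: `ClassicalMuVanishesKleinDescent`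
(`classNumberPExp_restrict_eq_of_algEquiv`), `ClassicalMuVanishesNormRelationTower` (`classNumberPExp_eq_of_isCyclotomic`),
`ClassNumberPExpCoprimeGaloisCongruence` (`classicalLambda_eq_of_isCyclotomic`), `ZpExtensionRestrictTwoSqrtTwoAnyDegree`.
-/

noncomputable section

open scoped NumberField

namespace Literature.NumberTheory.IwasawaTheory

open Field Literature.NumberTheory.EllipticCurves Literature.NumberTheory.EllipticCurves.ZpExtension
  Literature.NumberTheory.GaloisRepresentations

variable {E E' : Type} [Field E] [NumberField E] [Field E'] [NumberField E']

/-- `√2 ∉ E` passes along a `ℚ`-isomorphism. [folklore] -/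
private theorem forall_sq_ne_two_of_algEquiv (φ : E ≃ₐ[ℚ] E') (h2 : ∀ x : E, x ^ 2 ≠ 2) : ∀ x' : E', x' ^ 2 ≠ 2 := fun x' hx' ↦
  h2 (φ.symm x') (by rw [← map_pow, hx', map_ofNat])

/-- **`e_n` of the cyclotomic `ℤ₂`-towers is invariant under `ℚ`-isomorphisms of the base field, any degree, given `√2 ∉ E`**: for `φ : E ≃ₐ[ℚ] E'`,
`∀ x : E, x² ≠ 2`, and cyclotomic `ℤ₂`-extensions `κ` of `E`, `κ'` of `E'`: `e_n(κ) = e_n(κ')` for all `n` (both towers are restrictions of the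
cyclotomic tower of `ℚ`, `E ∩ ℚ_∞ = ℚ = E' ∩ ℚ_∞`, and the restricted towers are transported by `classNumberPExp_restrict_eq_of_algEquiv`).
[cite: Washington1997, §13.1] -/
theorem classNumberPExp_eq_of_algEquiv_of_forall_sq_ne_two (φ : E ≃ₐ[ℚ] E') (h2 : ∀ x : E, x ^ 2 ≠ 2)
    (κ : ZpExtension E 2) (hκ : κ.IsCyclotomic) (κ' : ZpExtension E' 2) (hκ' : κ'.IsCyclotomic) (n : ℕ) :
    classNumberPExp κ n = classNumberPExp κ' n := by
  obtain ⟨κ₀, hκ₀⟩ := exists_cyclotomicZpExtension_holds ℚ 2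
  have hE := surjective_comp_absGaloisRestrict_of_forall_sq_ne_two' κ₀ E hκ₀ h2
  have hE' := surjective_comp_absGaloisRestrict_of_forall_sq_ne_two' κ₀ E' hκ₀ (forall_sq_ne_two_of_algEquiv φ h2)
  rw [classNumberPExp_eq_of_isCyclotomic κ (κ₀.restrict E hE) hκ (isCyclotomic_restrict κ₀ hκ₀ E hE) n,
    classNumberPExp_eq_of_isCyclotomic κ' (κ₀.restrict E' hE') hκ' (isCyclotomic_restrict κ₀ hκ₀ E' hE') n]
  exact classNumberPExp_restrict_eq_of_algEquiv κ₀ φ hE hE' n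

/-- **`μ = 0` (growth form) for the cyclotomic towers is invariant under `ℚ`-isomorphisms, any degree, given `√2 ∉ E`.**
[cite: Washington1997, §13.1] [cite: RaySujatha2021, §1 eq. (1.1)] -/
theorem classicalMuVanishes_iff_of_algEquiv_of_forall_sq_ne_two (φ : E ≃ₐ[ℚ] E') (h2 : ∀ x : E, x ^ 2 ≠ 2)
    (κ : ZpExtension E 2) (hκ : κ.IsCyclotomic) (κ' : ZpExtension E' 2) (hκ' : κ'.IsCyclotomic) :
    ClassicalMuVanishes κ ↔ ClassicalMuVanishes κ' := by
  simp only [ClassicalMuVanishes, classNumberPExp_eq_of_algEquiv_of_forall_sq_ne_two φ h2 κ hκ κ' hκ']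

/-- **The input «`μ = 0` for every cyclotomic `ℤ₂`-extension» passes along `E ≃ₐ[ℚ] E'`, any degree, given `√2 ∉ E`** — the even-degree twin
of `forall_classicalMuVanishes_of_algEquiv` (which needs `2 ∤ [E : ℚ]`). [cite: Washington1997, §13.1] [cite: RaySujatha2021, §1 eq. (1.1)] -/
theorem forall_classicalMuVanishes_iff_of_algEquiv_of_forall_sq_ne_two (φ : E ≃ₐ[ℚ] E') (h2 : ∀ x : E, x ^ 2 ≠ 2) :
    (∀ κ : ZpExtension E 2, κ.IsCyclotomic → ClassicalMuVanishes κ) ↔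
      ∀ κ' : ZpExtension E' 2, κ'.IsCyclotomic → ClassicalMuVanishes κ' := by
  obtain ⟨κ₁, hκ₁⟩ := exists_cyclotomicZpExtension_holds E 2
  obtain ⟨κ₂, hκ₂⟩ := exists_cyclotomicZpExtension_holds E' 2
  exact ⟨fun h κ' hκ' ↦ (classicalMuVanishes_iff_of_algEquiv_of_forall_sq_ne_two φ h2 κ₁ hκ₁ κ' hκ').mp (h κ₁ hκ₁),
    fun h κ hκ ↦ (classicalMuVanishes_iff_of_algEquiv_of_forall_sq_ne_two φ h2 κ hκ κ₂ hκ₂).mpr (h κ₂ hκ₂)⟩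

/-- **`λ` (growth form) of the cyclotomic towers is invariant under `ℚ`-isomorphisms, any degree, given `√2 ∉ E`** (`λ` is determined by the
sequence `e_n`). [cite: Washington1997, §13.3 Thm. 13.13] -/
theorem classicalLambda_eq_of_algEquiv_of_forall_sq_ne_two (φ : E ≃ₐ[ℚ] E') (h2 : ∀ x : E, x ^ 2 ≠ 2)
    (κ : ZpExtension E 2) (hκ : κ.IsCyclotomic) (κ' : ZpExtension E' 2) (hκ' : κ'.IsCyclotomic) :
    classicalLambda κ = classicalLambda κ' := by
  have he : ∀ n, classNumberPExp κ n = classNumberPExp κ' n :=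
    fun n ↦ classNumberPExp_eq_of_algEquiv_of_forall_sq_ne_two φ h2 κ hκ κ' hκ' n
  by_cases hμ : ClassicalMuVanishes κ
  · obtain ⟨ν, n₀, hν⟩ := classicalLambda_spec κ hμ
    exact eq_classicalLambda_of_growth κ' (ν := ν) (n₀ := n₀) fun n hn ↦ by rw [← he n]; exact hν n hn
  · have hμ' : ¬ ClassicalMuVanishes κ' := fun h' ↦
      hμ ((classicalMuVanishes_iff_of_algEquiv_of_forall_sq_ne_two φ h2 κ hκ κ' hκ').mpr h')
    rw [classicalLambda_eq_zero_of_not_classicalMuVanishes κ hμ, classicalLambda_eq_zero_of_not_classicalMuVanishes κ' hμ']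

end Literature.NumberTheory.IwasawaTheory

end
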